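import Literature.AlgebraicGeometry.FundamentalGroup.RiemannExistenceCurves
import Literature.AlgebraicGeometry.FundamentalGroup.RiemannExistenceSeparatingIff
import Literature.AlgebraicGeometry.HodgeTheory.AndreottiFrankelAffine
import HarnessLib

/-!
# Algebraic separating functions on finite coverings: relative dimension `≤ 1`

Layer `Literature/AlgebraicGeometry/FundamentalGroup`. The transcendental residual of Riemann's
existence theorem (SGA1 XII Thm. 5.1) isolated in this directory is, for SMOOTH bases, the
right-hand side of `riemannExistence_smooth_iff_algebraicSeparating`: for every smooth irreducible
affine `ℂ`-scheme `S`, every finite-fibred covering map `q : T → S(ℂ)` and every `P₀ ∈ S(ℂ)`, a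
continuous `h : T → ℂ`, ALGEBRAIC over `Γ(S, 𝒪_S)` along `q` (`F^{q t}(h t) = 0` for one non-zero
`F ∈ Γ(S, 𝒪_S)[Y]`) and injective on `q⁻¹(P₀)` (the hypothesis of
`riemannExistence_qbarDescent_of_finiteIndex_of_algebraicSeparating`). This file PROVES that residual
in relative dimension `0` and `1`:

* `algebraicSeparating_of_smoothOfRelativeDimension_zero` — `S(ℂ)` is discrete
  (`AffineCoordinates.discreteTopology_complexPoints_of_smoothOfRelativeDimension_zero`), hence so is
  `T`; number the finite fibre `q⁻¹(P₀)` by `0, …, k-1`, extend by `0`, and take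
  `F = Y · ∏_{i<k} (Y - i)`, a monic polynomial with INTEGER coefficients;
* `algebraicSeparating_of_smoothOfRelativeDimension_one` — the curve case of the transcendental
  input (`integralSeparating_of_smoothOfRelativeDimension_one`, Forster §8/§14 made algebraic by a
  Noether projection; landed 2026-08-17), a monic polynomial over the domain `Γ(S, 𝒪_S)` being
  non-zero;
* `algebraicSeparating_of_smoothOfRelativeDimension_le_one` — both cases from
  `SmoothOfRelativeDimension n`, `n ≤ 1`.

So the residual is open exactly in relative dimension `≥ 2` (the all-dimensional statement needs
Grauert–Remmert / GAGA on a compactification). Everything is proved; there are no definitions.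

## References

* A. Grothendieck, M. Raynaud, *SGA 1*, Exp. XII Thm. 5.1 (p. 333), proof, part 2. [SGA1]
* O. Forster, *Lectures on Riemann Surfaces*, GTM 81, Springer (1981), §8 Thm. 8.4. [Forster1981]

#harness_tags algebraic_geometry.sga1, algebraic_geometry.hodge_conjecture
-/

noncomputable section

open CategoryTheory AlgebraicGeometry Set Polynomial
open _root_.Topology

namespace Literature.AlgebraicGeometry.FundamentalGroup

open Literature.AlgebraicGeometry.Motives Literature.AlgebraicGeometry.Motives.AlgPoints
open Literature.AlgebraicGeometry.Resolution
open Literature.AlgebraicGeometry.HodgeTheory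

/-- A covering space of a discrete space is discrete: every point has an open neighbourhood mapped
homeomorphically onto an open subset of the (discrete) base. [folklore] -/
theorem discreteTopology_of_isCoveringMap_of_discreteTopology {T B : Type*} [TopologicalSpace T]
    [TopologicalSpace B] [DiscreteTopology B] {q : T → B} (hq : IsCoveringMap q) :
    DiscreteTopology T := by
  refine discreteTopology_iff_isOpen_singleton.2 fun t ↦ ?_
  obtain ⟨e, hte, rfl⟩ := hq.isLocalHomeomorph t
  have hopen : IsOpen (e.source ∩ e ⁻¹' {e t}) := e.isOpen_inter_preimage (isOpen_discrete _)
  have heq : e.source ∩ e ⁻¹' {e t} = {t} := by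
    refine Set.eq_singleton_iff_unique_mem.2 ⟨⟨hte, rfl⟩, fun u hu ↦ ?_⟩
    exact e.injOn hu.1 hte hu.2
  exact heq ▸ hopen

/-- **Algebraic separating functions in relative dimension `0`.** For `S` affine, smooth of relative
dimension `0` (étale) over `ℂ`, every finite-fibred covering map `q : T → S(ℂ)` and every
`P₀ ∈ S(ℂ)`: a continuous `h : T → ℂ`, algebraic over `Γ(S, 𝒪_S)` along `q` and injective on
`q⁻¹(P₀)`. `S(ℂ)` and hence `T` are discrete; number the fibre over `P₀` by `0, …, k - 1`, put
`h = 0` elsewhere, and take `F = Y · ∏_{i<k} (Y - i)`. [cite: SGA1, Exp. XII Thm. 5.1 (p. 333), proof, part 2] -/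
theorem algebraicSeparating_of_smoothOfRelativeDimension_zero (S : Motives.SchemeOver ℂ)
    [SmoothOfRelativeDimension 0 S.hom] {T : Type} [TopologicalSpace T]
    (q : T → Motives.ComplexPoints S) (hq : IsCoveringMap q) (hfin : ∀ P, (q ⁻¹' {P}).Finite)
    (P₀ : Motives.ComplexPoints S) :
    ∃ (h : T → ℂ) (F : Polynomial Γ(S.left, ⊤)), Continuous h ∧ F ≠ 0 ∧
      (∀ t, (F.map ((q t).evalRingHom ⊤ trivial)).eval (h t) = 0) ∧ Set.InjOn h (q ⁻¹' {P₀}) := by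
  classical
  haveI : Smooth S.hom := SmoothOfRelativeDimension.smooth 0 S.hom
  haveI : LocallyOfFiniteType S.hom := inferInstance
  haveI : DiscreteTopology (Motives.ComplexPoints S) :=
    AffineCoordinates.discreteTopology_complexPoints_of_smoothOfRelativeDimension_zero S
  haveI : DiscreteTopology T := discreteTopology_of_isCoveringMap_of_discreteTopology hq
  -- number the finite fibre over `P₀`
  haveI : Finite (q ⁻¹' {P₀}) := (hfin P₀).to_subtype
  set k : ℕ := Nat.card (q ⁻¹' {P₀}) with hk
  let e : (q ⁻¹' {P₀}) ≃ Fin k := Finite.equivFin _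
  let h : T → ℂ := fun t ↦ if ht : t ∈ q ⁻¹' {P₀} then ((e ⟨t, ht⟩ : ℕ) : ℂ) else 0
  -- the monic integer polynomial `Y · ∏_{i<k} (Y - i)`
  let F : Polynomial Γ(S.left, ⊤) := X * ∏ i ∈ Finset.range k, (X - C (i : Γ(S.left, ⊤)))
  have hFmap : ∀ P : Motives.ComplexPoints S, F.map (P.evalRingHom ⊤ trivial) =
      X * ∏ i ∈ Finset.range k, (X - C (i : ℂ)) := fun P ↦ by
    simp only [F, Polynomial.map_mul, Polynomial.map_prod, Polynomial.map_sub, Polynomial.map_X,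
      Polynomial.map_natCast, map_natCast]
  have hmonic : (X * ∏ i ∈ Finset.range k, (X - C (i : ℂ))).Monic :=
    monic_X.mul (monic_prod_of_monic _ _ fun i _ ↦ monic_X_sub_C _)
  refine ⟨h, F, continuous_of_discreteTopology, ?_, fun t ↦ ?_, ?_⟩
  · -- `F ≠ 0`: its image at `P₀` is a monic complex polynomial
    intro hF
    have h0 : F.map (P₀.evalRingHom ⊤ trivial) = 0 := by rw [hF, Polynomial.map_zero]
    exact hmonic.ne_zero ((hFmap P₀).symm.trans h0)
  · -- every value of `h` is a root of `Y · ∏ (Y - i)`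
    rw [hFmap (q t), Polynomial.eval_mul, Polynomial.eval_X]
    by_cases ht : t ∈ q ⁻¹' {P₀}
    · have hht : h t = ((e ⟨t, ht⟩ : ℕ) : ℂ) := dif_pos ht
      have hlt : ((e ⟨t, ht⟩ : ℕ)) ∈ Finset.range k := Finset.mem_range.2 (e ⟨t, ht⟩).isLt
      refine mul_eq_zero_of_right _ ?_
      rw [Polynomial.eval_prod]
      refine Finset.prod_eq_zero hlt ?_
      rw [Polynomial.eval_sub, Polynomial.eval_X, Polynomial.eval_C, hht, sub_self]
    · have hht : h t = 0 := dif_neg ht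
      rw [hht, zero_mul]
  · -- injective on the fibre over `P₀`
    intro t₁ ht₁ t₂ ht₂ h12
    have h₁ : h t₁ = ((e ⟨t₁, ht₁⟩ : ℕ) : ℂ) := dif_pos ht₁
    have h₂ : h t₂ = ((e ⟨t₂, ht₂⟩ : ℕ) : ℂ) := dif_pos ht₂
    have h12' : ((e ⟨t₁, ht₁⟩ : ℕ) : ℂ) = ((e ⟨t₂, ht₂⟩ : ℕ) : ℂ) := h₁ ▸ h₂ ▸ h12
    have := e.injective (Fin.ext (Nat.cast_injective h12'))
    exact congrArg Subtype.val this

/-- **Algebraic separating functions in relative dimension `1`** (the curve case of the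
transcendental half of SGA1 XII 5.1, from `integralSeparating_of_smoothOfRelativeDimension_one`:
Forster's Riemann existence theorem for the Riemann surface `T`, made algebraic over `Γ(S, 𝒪_S)` by
a Noether projection): for `S` a smooth irreducible affine curve over `ℂ`, every finite-fibred
covering `q : T → S(ℂ)` and every `P₀` admit a continuous `h : T → ℂ`, algebraic over `Γ(S, 𝒪_S)`
along `q` (even integral) and injective on `q⁻¹(P₀)`. [cite: SGA1, Exp. XII Thm. 5.1 (p. 333), proof, part 2]
[cite: Forster1981, §8 Thm. 8.4] -/
theorem algebraicSeparating_of_smoothOfRelativeDimension_one (S : Motives.SchemeOver ℂ)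
    [IsAffine S.left] [SmoothOfRelativeDimension 1 S.hom] [IrreducibleSpace S.left]
    {T : Type} [TopologicalSpace T] (q : T → Motives.ComplexPoints S) (hq : IsCoveringMap q)
    (hfin : ∀ P, (q ⁻¹' {P}).Finite) (P₀ : Motives.ComplexPoints S) :
    ∃ (h : T → ℂ) (F : Polynomial Γ(S.left, ⊤)), Continuous h ∧ F ≠ 0 ∧
      (∀ t, (F.map ((q t).evalRingHom ⊤ trivial)).eval (h t) = 0) ∧ Set.InjOn h (q ⁻¹' {P₀}) := by
  haveI : Smooth S.hom := SmoothOfRelativeDimension.smooth 1 S.hom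
  -- `Γ(S, 𝒪_S)` is a domain (`S` smooth, hence reduced, and irreducible), so monic ⇒ non-zero
  have hSreg : Scheme.IsRegular S.left :=
    Scheme.IsRegular.of_smooth S.hom (Scheme.isRegular_Spec (CommRingCat.of ℂ))
  haveI : IsReduced S.left := hSreg.isReduced
  haveI : IsIntegral S.left := isIntegral_of_irreducibleSpace_of_isReduced _
  obtain ⟨h, R, hh, hR, hroot, hinj⟩ := integralSeparating_of_smoothOfRelativeDimension_one S hq hfin P₀
  exact ⟨h, R, hh, hR.ne_zero, hroot, hinj⟩

/-- **The separating-function residual of Riemann's existence theorem holds in relative dimension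
`≤ 1`**: for `S` affine irreducible, smooth of relative dimension `n ≤ 1` over `ℂ`, every
finite-fibred covering of `S(ℂ)` carries algebraic separating functions
(`algebraicSeparating_of_smoothOfRelativeDimension_zero`, `…_one`). The residual
(`riemannExistence_smooth_iff_algebraicSeparating`) is therefore open exactly in relative dimension
`≥ 2`. [cite: SGA1, Exp. XII Thm. 5.1 (p. 333), proof, part 2] -/
theorem algebraicSeparating_of_smoothOfRelativeDimension_le_one {n : ℕ} (hn : n ≤ 1)
    (S : Motives.SchemeOver ℂ) [IsAffine S.left] [SmoothOfRelativeDimension n S.hom]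
    [IrreducibleSpace S.left] {T : Type} [TopologicalSpace T] (q : T → Motives.ComplexPoints S)
    (hq : IsCoveringMap q) (hfin : ∀ P, (q ⁻¹' {P}).Finite) (P₀ : Motives.ComplexPoints S) :
    ∃ (h : T → ℂ) (F : Polynomial Γ(S.left, ⊤)), Continuous h ∧ F ≠ 0 ∧
      (∀ t, (F.map ((q t).evalRingHom ⊤ trivial)).eval (h t) = 0) ∧ Set.InjOn h (q ⁻¹' {P₀}) := by
  interval_cases n
  · exact algebraicSeparating_of_smoothOfRelativeDimension_zero S q hq hfin P₀
  · exact algebraicSeparating_of_smoothOfRelativeDimension_one S q hq hfin P₀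

end Literature.AlgebraicGeometry.FundamentalGroup

end
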